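import Summits.QuantumAdvantage.QuantumAdvantage.Theorems.CharDialTransferDialF
import HarnessLib

/-!
# TransferDial G — kernel of `RainbowBound` (piece C of part F), I: jump symmetries (K1)

`RainbowBound` (part F: a Boolean function with `≤ R` distinct rows for EVERY bipartition of its coordinates has no rainbow —
pairwise non-exchangeable — coordinate set of more than `N(R)` elements) is PROVED in parts G–J (`Model.rainbowBound`, part J), so
the carving of part F reads `PartnersTwoOdd ⟸ SliceFewTwoOdd` and, modulo the field core PF, piece B `StructureLawTwoOdd ⟺ SliceFewTwoOdd`
(`structureLaw_iff_sliceFew_of_PF`, part J).  Proof route: hypergraph-Ramsey homogenisation of the restriction sets `Φ(W)` (part J), a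
pigeonhole on restriction pairs producing ONE jump relation for the whole top level, propagation to every location by front/back letter
deletions and descent of symmetry along first-letter restrictions (part H), and — this part — the elementary fact that a function of binary
words of length `n ≥ 2L + 2` invariant under every «jump of one letter over the next `L` letters» is invariant under every transposition:
the composites (left jump at `q+1`) ∘ (right jump at `q`) are 3-cycles of positions, and on BINARY words a 3-cycle acts on the three letters
read as a transposition or trivially (the third letter equals one of the other two).

Tree twin, part G of the decomp-qadv lens-6 g23 addendum (`g23/RainbowKernel.lean` §JumpSym, declaration bodies verbatim, namespace
`…Theses.SliceDial.JumpSym` ↦ `…Theorems.TransferDial.JumpSym`).  0 sorry; no `instance`, no `notation`, no `native_decide`; Mathlib only.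
-/

set_option autoImplicit false
set_option linter.dupNamespace false

namespace Summit.QuantumAdvantage.QuantumAdvantage.Theorems.TransferDial.JumpSym

variable {n : ℕ} {V : Type*}

/-! ## 3-cycles of positions acting on words -/

/-- `cyc a b c x`: the word whose letter at `a` is the old letter at `b`, at `b` the old letter at `c`,
at `c` the old letter at `a` (a 3-cycle of positions), unchanged elsewhere. -/
def cyc (a b c : Fin n) (x : Fin n → Bool) : Fin n → Bool :=
  fun i => if i = a then x b else if i = b then x c else if i = c then x a else x i

/-- The 3-cycles `cyc a b c` and `cyc a c b` of positions are mutually inverse on words. -/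
theorem cyc_inv (a b c : Fin n) (hab : a ≠ b) (hbc : b ≠ c) (hac : a ≠ c)
    (x : Fin n → Bool) : cyc a b c (cyc b a c x) = x := by
  funext i
  unfold cyc
  by_cases hia : i = a
  · subst hia; simp
  · by_cases hib : i = b
    · subst hib; simp [hab.symm, hbc.symm, hac.symm]
    · by_cases hic : i = c
      · subst hic; simp [hab, hbc.symm, hac.symm]
      · simp [hia, hib, hic]

/-- On BINARY words a 3-cycle through `a`, `b` and a third position `r` whose letter equals the letter
at `a` realises the transposition `(a b)`. -/
theorem swap_eq_cyc (a b r : Fin n) (hab : a ≠ b) (hbr : b ≠ r) (har : a ≠ r)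
    (x : Fin n → Bool) (h : x r = x a) :
    (fun i => x (Equiv.swap a b i)) = cyc a b r x := by
  funext i
  unfold cyc
  by_cases hia : i = a
  · subst hia; simp [Equiv.swap_apply_left]
  · by_cases hib : i = b
    · subst hib; simp [Equiv.swap_apply_right, hia, h]
    · by_cases hir : i = r
      · subst hir; simp [Equiv.swap_apply_of_ne_of_ne hia hib, hia, hib, h]
      · simp [Equiv.swap_apply_of_ne_of_ne hia hib, hia, hib, hir]

/-- The mirror case: the third letter equals the letter at `b`. -/
theorem swap_eq_cyc' (a b r : Fin n) (hab : a ≠ b) (hbr : b ≠ r) (har : a ≠ r)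
    (x : Fin n → Bool) (h : x r = x b) :
    (fun i => x (Equiv.swap a b i)) = cyc b a r x := by
  funext i
  unfold cyc
  by_cases hib : i = b
  · subst hib; simp [Equiv.swap_apply_right]
  · by_cases hia : i = a
    · subst hia; simp [Equiv.swap_apply_left, hib, h]
    · by_cases hir : i = r
      · subst hir; simp [Equiv.swap_apply_of_ne_of_ne hia hib, hia, hib, h]
      · simp [Equiv.swap_apply_of_ne_of_ne hia hib, hia, hib, hir]

/-- If the swap does nothing to the word. -/
theorem swap_eq_self (a b : Fin n) (x : Fin n → Bool) (h : x a = x b) :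
    (fun i => x (Equiv.swap a b i)) = x := by
  funext i
  by_cases h1 : i = a
  · subst h1; simp [h]
  · by_cases h2 : i = b
    · subst h2; simp [h]
    · simp [Equiv.swap_apply_of_ne_of_ne h1 h2]

/-! ## Jumps -/

/-- Index map of the right jump at location `q` with block length `L`: the new word reads, at position
`i`, the old position `jrIdx L q i` (positions `q ≤ i < q+L` read `i+1`, position `q+L` reads `q`). -/
def jrIdx (L q : ℕ) (i : Fin n) : Fin n :=
  if h : q ≤ i.val ∧ i.val < q + L ∧ i.val + 1 < n then ⟨i.val + 1, h.2.2⟩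
  else if h' : i.val = q + L ∧ q < n then ⟨q, h'.2⟩ else i

/-- Index map of the left jump (inverse of the right jump): positions `q < i ≤ q+L` read `i-1`,
position `q` reads `q+L`. -/
def jlIdx (L q : ℕ) (i : Fin n) : Fin n :=
  if h : q < i.val ∧ i.val ≤ q + L then ⟨i.val - 1, by omega⟩
  else if h' : i.val = q ∧ q + L < n then ⟨q + L, h'.2⟩ else i

/-- The letter at `q` jumps rightwards over the next `L` letters. -/
def jr (L q : ℕ) (x : Fin n → Bool) : Fin n → Bool := fun i => x (jrIdx L q i)

/-- The letter at `q+L` jumps leftwards over the previous `L` letters (to position `q`). -/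
def jl (L q : ℕ) (x : Fin n → Bool) : Fin n → Bool := fun i => x (jlIdx L q i)

/-- The value of the right-jump index map. -/
theorem jrIdx_val (L q : ℕ) (hq : q + L < n) (i : Fin n) :
    (jrIdx L q i).val = if q ≤ i.val ∧ i.val < q + L then i.val + 1
      else if i.val = q + L then q else i.val := by
  unfold jrIdx
  split_ifs <;> (try dsimp only at *) <;> omega

/-- The value of the left-jump index map. -/
theorem jlIdx_val (L q : ℕ) (hq : q + L < n) (i : Fin n) :
    (jlIdx L q i).val = if q < i.val ∧ i.val ≤ q + L then i.val - 1
      else if i.val = q then q + L else i.val := by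
  unfold jlIdx
  split_ifs <;> (try dsimp only at *) <;> omega

/-- `jlIdx` is a left inverse of `jrIdx`. -/
theorem jlIdx_jrIdx (L q : ℕ) (hq : q + L < n) (i : Fin n) : jlIdx L q (jrIdx (n := n) L q i) = i := by
  apply Fin.ext
  rw [jlIdx_val L q hq, jrIdx_val L q hq]
  split_ifs <;> omega

/-- A right jump undoes a left jump. -/
theorem jr_jl (L q : ℕ) (hq : q + L < n) (x : Fin n → Bool) : jr L q (jl L q x) = x := by
  funext i
  show x (jlIdx L q (jrIdx L q i)) = x i
  rw [jlIdx_jrIdx L q hq]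

/-- σ_q := (left jump at q+1) ∘ (right jump at q) is the 3-cycle of positions: new `q` ← old `q+1`,
new `q+1` ← old `q+L+1`, new `q+L+1` ← old `q`. -/
theorem sigma_eq (L q : ℕ) (hL : 1 ≤ L) (hq : q + L + 1 < n) (x : Fin n → Bool) :
    jl L (q + 1) (jr L q x)
      = cyc ⟨q, by omega⟩ ⟨q + 1, by omega⟩ ⟨q + L + 1, by omega⟩ x := by
  funext i
  show x (jrIdx L q (jlIdx L (q+1) i)) = _
  unfold cyc jrIdx jlIdx
  by_cases hA : q + 1 < i.val ∧ i.val ≤ q + 1 + L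
  · -- window of the left jump: reads i-1, then the right jump
    rw [dif_pos hA]
    have hi1 : i ≠ ⟨q, by omega⟩ := by intro h; rw [Fin.ext_iff] at h; simp at h; omega
    have hi2 : i ≠ ⟨q + 1, by omega⟩ := by intro h; rw [Fin.ext_iff] at h; simp at h; omega
    rw [if_neg hi1, if_neg hi2]
    by_cases hi3 : i.val = q + L + 1
    · have hi3' : i = ⟨q + L + 1, by omega⟩ := Fin.ext hi3
      rw [if_pos hi3']
      have hB : ¬ (q ≤ i.val - 1 ∧ i.val - 1 < q + L ∧ i.val - 1 + 1 < n) := by omega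
      simp only [hB, ↓reduceDIte]
      have hC : (i.val - 1 = q + L ∧ q < n) := ⟨by omega, by omega⟩
      rw [dif_pos hC]
    · have hi3' : i ≠ ⟨q + L + 1, by omega⟩ := by intro h; rw [Fin.ext_iff] at h; simp at h; omega
      rw [if_neg hi3']
      have hB : (q ≤ i.val - 1 ∧ i.val - 1 < q + L ∧ i.val - 1 + 1 < n) := ⟨by omega, by omega, by omega⟩
      rw [dif_pos hB]
      first | rfl | (congr 1; apply Fin.ext; dsimp only; omega)
  · rw [dif_neg hA]
    by_cases hB : i.val = q + 1 ∧ q + 1 + L < n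
    · rw [dif_pos hB]
      have hi2 : i = ⟨q + 1, by omega⟩ := Fin.ext hB.1
      have hi1 : i ≠ ⟨q, by omega⟩ := by intro h; rw [Fin.ext_iff] at h; simp at h; omega
      rw [if_neg hi1, if_pos hi2]
      have hC : ¬ (q ≤ q + 1 + L ∧ q + 1 + L < q + L ∧ q + 1 + L + 1 < n) := by omega
      simp only [hC, ↓reduceDIte]
      have hD : ¬ ((q + 1 + L = q + L) ∧ q < n) := by omega
      rw [dif_neg hD]
      first | rfl | (congr 1; apply Fin.ext; dsimp only; omega)
    · rw [dif_neg hB]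
      -- i outside the left-jump window and ≠ q+1 (as q+1+L < n holds): i ≤ q or i > q+1+L
      have hi : i.val ≤ q ∨ q + 1 + L < i.val := by omega
      by_cases hiq : i.val = q
      · have hiq' : i = ⟨q, by omega⟩ := Fin.ext hiq
        rw [if_pos hiq']
        have hC : (q ≤ i.val ∧ i.val < q + L ∧ i.val + 1 < n) := ⟨by omega, by omega, by omega⟩
        rw [dif_pos hC]
        first | rfl | (congr 1; apply Fin.ext; dsimp only; omega)
      · have hi1 : i ≠ ⟨q, by omega⟩ := by intro h; exact hiq (by rw [Fin.ext_iff] at h; simpa using h)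
        have hi2 : i ≠ ⟨q + 1, by omega⟩ := by intro h; rw [Fin.ext_iff] at h; simp at h; omega
        have hi3 : i ≠ ⟨q + L + 1, by omega⟩ := by intro h; rw [Fin.ext_iff] at h; simp at h; omega
        rw [if_neg hi1, if_neg hi2, if_neg hi3]
        have hC : ¬ (q ≤ i.val ∧ i.val < q + L ∧ i.val + 1 < n) := by omega
        rw [dif_neg hC]
        have hD : ¬ (i.val = q + L ∧ q < n) := by omega
        rw [dif_neg hD]

/-- π_q := (right jump at q) ∘ (left jump at q+1) is the 3-cycle: new `q` ← old `q+L+1`,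
new `q+L+1` ← old `q+L`, new `q+L` ← old `q`. -/
theorem pi_eq (L q : ℕ) (hL : 1 ≤ L) (hq : q + L + 1 < n) (x : Fin n → Bool) :
    jr L q (jl L (q + 1) x)
      = cyc ⟨q, by omega⟩ ⟨q + L + 1, by omega⟩ ⟨q + L, by omega⟩ x := by
  funext i
  show x (jlIdx L (q+1) (jrIdx L q i)) = _
  unfold cyc jrIdx jlIdx
  by_cases hA : q ≤ i.val ∧ i.val < q + L ∧ i.val + 1 < n
  · rw [dif_pos hA]
    have hi2 : i ≠ ⟨q + L + 1, by omega⟩ := by intro h; rw [Fin.ext_iff] at h; simp at h; omega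
    have hi3 : i ≠ ⟨q + L, by omega⟩ := by intro h; rw [Fin.ext_iff] at h; simp at h; omega
    by_cases hiq : i.val = q
    · have hiq' : i = ⟨q, by omega⟩ := Fin.ext hiq
      rw [if_pos hiq']
      have hB : ¬ (q + 1 < i.val + 1 ∧ i.val + 1 ≤ q + 1 + L) := by omega
      simp only [hB, ↓reduceDIte]
      have hC : (i.val + 1 = q + 1 ∧ q + 1 + L < n) := ⟨by omega, by omega⟩
      rw [dif_pos hC]
      first | rfl | (congr 1; apply Fin.ext; dsimp only; omega)
    · have hi1 : i ≠ ⟨q, by omega⟩ := by intro h; exact hiq (by rw [Fin.ext_iff] at h; simpa using h)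
      rw [if_neg hi1, if_neg hi2, if_neg hi3]
      have hB : (q + 1 < i.val + 1 ∧ i.val + 1 ≤ q + 1 + L) := ⟨by omega, by omega⟩
      rw [dif_pos hB]
      rfl
  · rw [dif_neg hA]
    by_cases hB : i.val = q + L ∧ q < n
    · rw [dif_pos hB]
      have hi3 : i = ⟨q + L, by omega⟩ := Fin.ext hB.1
      have hi1 : i ≠ ⟨q, by omega⟩ := by intro h; rw [Fin.ext_iff] at h; simp at h; omega
      have hi2 : i ≠ ⟨q + L + 1, by omega⟩ := by intro h; rw [Fin.ext_iff] at h; simp at h; omega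
      rw [if_neg hi1, if_neg hi2, if_pos hi3]
      have hC : ¬ (q + 1 < q ∧ q ≤ q + 1 + L) := by omega
      simp only [hC, ↓reduceDIte]
      have hD : ¬ (q = q + 1 ∧ q + 1 + L < n) := by omega
      rw [dif_neg hD]
    · rw [dif_neg hB]
      have hi : i.val < q ∨ q + L < i.val := by omega
      have hi1 : i ≠ ⟨q, by omega⟩ := by intro h; rw [Fin.ext_iff] at h; simp at h; omega
      have hi3 : i ≠ ⟨q + L, by omega⟩ := by intro h; rw [Fin.ext_iff] at h; simp at h; omega
      rw [if_neg hi1]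
      by_cases hi2 : i.val = q + L + 1
      · have hi2' : i = ⟨q + L + 1, by omega⟩ := Fin.ext hi2
        rw [if_pos hi2']
        have hC : (q + 1 < i.val ∧ i.val ≤ q + 1 + L) := ⟨by omega, by omega⟩
        rw [dif_pos hC]
        first | rfl | (congr 1; apply Fin.ext; dsimp only; omega)
      · have hi2' : i ≠ ⟨q + L + 1, by omega⟩ := by intro h; rw [Fin.ext_iff] at h; simp at h; omega
        rw [if_neg hi2', if_neg hi3]
        have hC : ¬ (q + 1 < i.val ∧ i.val ≤ q + 1 + L) := by omega
        rw [dif_neg hC]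
        have hD : ¬ (i.val = q + 1 ∧ q + 1 + L < n) := by omega
        rw [dif_neg hD]

/-! ## The symmetrisation theorem -/

/-- From the two 3-cycle symmetries through an adjacent pair and a third position, the adjacent
transposition is a symmetry (binary alphabet!). -/
theorem swap_of_cyc3 (ψ : (Fin n → Bool) → V) (a b r : Fin n) (hab : a ≠ b) (hbr : b ≠ r)
    (har : a ≠ r) (hP : ∀ y, ψ (cyc a b r y) = ψ y) (hM : ∀ y, ψ (cyc b a r y) = ψ y)
    (x : Fin n → Bool) : ψ (fun i => x (Equiv.swap a b i)) = ψ x := by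
  by_cases hx : x r = x a
  · rw [swap_eq_cyc a b r hab hbr har x hx]; exact hP x
  · by_cases hx' : x r = x b
    · rw [swap_eq_cyc' a b r hab hbr har x hx']; exact hM x
    · have hab2 : x a = x b := by
        cases hra : x r <;> cases hxa : x a <;> cases hxb : x b <;> simp_all
      rw [swap_eq_self a b x hab2]

/-- `cyc` is invariant under cyclic relabelling of its three positions. -/
theorem cyc_rot (a b c : Fin n) (hab : a ≠ b) (hbc : b ≠ c) (hac : a ≠ c) (y : Fin n → Bool) :
    cyc a b c y = cyc b c a y := by
  funext i; unfold cyc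
  by_cases h1 : i = a
  · subst h1; simp [hab, hac]
  · by_cases h2 : i = b
    · subst h2; simp [h1]
    · by_cases h3 : i = c
      · subst h3; simp [h1, h2]
      · simp [h1, h2, h3]

/-- K1 (RAINBOW-PROOF §5): jump invariance at every location, with `1 ≤ L` and `2L+2 ≤ n`, forces
invariance under every ADJACENT transposition. -/
theorem swap_adj_of_jump (ψ : (Fin n → Bool) → V) (L : ℕ) (hL : 1 ≤ L) (hn : 2 * L + 2 ≤ n)
    (hJ : ∀ q : ℕ, q + L < n → ∀ x : Fin n → Bool, ψ (jr L q x) = ψ x)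
    (a b : Fin n) (hab : b.val = a.val + 1) (x : Fin n → Bool) :
    ψ (fun i => x (Equiv.swap a b i)) = ψ x := by
  -- left jumps are symmetries too
  have hJl : ∀ q : ℕ, q + L < n → ∀ x : Fin n → Bool, ψ (jl L q x) = ψ x := by
    intro q hq x
    have := hJ q hq (jl L q x)
    rw [jr_jl L q hq] at this
    exact this.symm
  -- the two families of 3-cycle symmetries
  have hσ : ∀ q : ℕ, ∀ hq : q + L + 1 < n, ∀ x,
      ψ (cyc ⟨q, by omega⟩ ⟨q + 1, by omega⟩ ⟨q + L + 1, by omega⟩ x) = ψ x := by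
    intro q hq x
    rw [← sigma_eq L q hL hq x, hJl (q+1) (by omega), hJ q (by omega)]
  have hπ : ∀ q : ℕ, ∀ hq : q + L + 1 < n, ∀ x,
      ψ (cyc ⟨q, by omega⟩ ⟨q + L + 1, by omega⟩ ⟨q + L, by omega⟩ x) = ψ x := by
    intro q hq x
    rw [← pi_eq L q hL hq x, hJ q (by omega), hJl (q+1) (by omega)]
  -- inverses of symmetries are symmetries
  have hinv : ∀ a b c : Fin n, a ≠ b → b ≠ c → a ≠ c →
      (∀ y, ψ (cyc a b c y) = ψ y) → ∀ y, ψ (cyc b a c y) = ψ y := by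
    intro a b c hab hbc hac h y
    have := h (cyc b a c y)
    rw [cyc_inv a b c hab hbc hac] at this
    exact this.symm
  have hne : a ≠ b := by intro h; rw [Fin.ext_iff] at h; omega
  by_cases hcase : a.val + L + 2 ≤ n
  · -- third position r := a + L + 1; σ_a is the 3-cycle `cyc a b r`
    have hq : a.val + L + 1 < n := by omega
    have ha' : (⟨a.val, by omega⟩ : Fin n) = a := Fin.ext rfl
    have hb' : (⟨a.val + 1, by omega⟩ : Fin n) = b := Fin.ext hab.symm
    have hP : ∀ y, ψ (cyc a b ⟨a.val + L + 1, hq⟩ y) = ψ y := by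
      intro y; have := hσ a.val hq y; rw [ha', hb'] at this; exact this
    have hbr : b ≠ ⟨a.val + L + 1, hq⟩ := by intro h; rw [Fin.ext_iff] at h; simp at h; omega
    have har : a ≠ ⟨a.val + L + 1, hq⟩ := by intro h; rw [Fin.ext_iff] at h; simp at h; omega
    exact swap_of_cyc3 ψ a b _ hne hbr har hP (hinv a b _ hne hbr har hP) x
  · -- third position r := a - L; π_{a-L} is the 3-cycle `cyc r b a = cyc b a r`
    have haL : L ≤ a.val := by omega
    have hq : (a.val - L) + L + 1 < n := by have := b.isLt; omega
    have h1' : (⟨a.val - L + L + 1, hq⟩ : Fin n) = b := by apply Fin.ext; simp; omega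
    have h2' : (⟨a.val - L + L, by omega⟩ : Fin n) = a := by apply Fin.ext; simp; omega
    have hr : a.val - L < n := by omega
    have hπ' : ∀ y, ψ (cyc ⟨a.val - L, hr⟩ b a y) = ψ y := by
      intro y; have := hπ (a.val - L) hq y; rw [h1', h2'] at this; exact this
    have hbr : b ≠ ⟨a.val - L, hr⟩ := by intro h; rw [Fin.ext_iff] at h; simp at h; omega
    have har : a ≠ ⟨a.val - L, hr⟩ := by intro h; rw [Fin.ext_iff] at h; simp at h; omega
    have hM : ∀ y, ψ (cyc b a ⟨a.val - L, hr⟩ y) = ψ y := by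
      intro y
      rw [cyc_rot b a _ hne.symm har hbr y, cyc_rot a _ b har hbr.symm hne y]
      exact hπ' y
    have hP : ∀ y, ψ (cyc a b ⟨a.val - L, hr⟩ y) = ψ y := by
      have := hinv b a _ hne.symm har hbr hM
      exact this
    exact swap_of_cyc3 ψ a b _ hne hbr har hP hM x

/-- COROLLARY: under the hypotheses of `swap_adj_of_jump`, `ψ` is invariant under EVERY transposition
(adjacent transpositions conjugate to all transpositions). -/
theorem swap_of_jump (ψ : (Fin n → Bool) → V) (L : ℕ) (hL : 1 ≤ L) (hn : 2 * L + 2 ≤ n)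
    (hJ : ∀ q : ℕ, q + L < n → ∀ x : Fin n → Bool, ψ (jr L q x) = ψ x)
    (a b : Fin n) (x : Fin n → Bool) :
    ψ (fun i => x (Equiv.swap a b i)) = ψ x := by
  -- induction on the distance, for a < b; then symmetry; a = b trivial
  have key : ∀ d : ℕ, ∀ a b : Fin n, b.val = a.val + d + 1 → ∀ x : Fin n → Bool,
      ψ (fun i => x (Equiv.swap a b i)) = ψ x := by
    intro d
    induction d with
    | zero => intro a b h x; exact swap_adj_of_jump ψ L hL hn hJ a b (by omega) x
    | succ d ih =>
      intro a b h x
      -- c := b - 1;  swap a b = swap c b * swap a c * swap c b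
      have hc : b.val - 1 < n := by omega
      have hac : a ≠ ⟨b.val - 1, hc⟩ := by intro e; rw [Fin.ext_iff] at e; simp at e; omega
      have hab : a ≠ b := by intro e; rw [Fin.ext_iff] at e; omega
      have hcb : b.val = (⟨b.val - 1, hc⟩ : Fin n).val + 1 := by simp; omega
      have hca : (⟨b.val - 1, hc⟩ : Fin n).val = a.val + d + 1 := by simp; omega
      have e1 : Equiv.swap a b
          = Equiv.swap ⟨b.val - 1, hc⟩ b * Equiv.swap a ⟨b.val - 1, hc⟩ * Equiv.swap ⟨b.val - 1, hc⟩ b := by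
        rw [Equiv.swap_mul_swap_mul_swap hac hab, Equiv.swap_comm]
      -- words along the way: x ∘ (cb) ∘ (ac) ∘ (cb)
      have step : (fun i => x (Equiv.swap a b i))
          = fun i => x (Equiv.swap ⟨b.val - 1, hc⟩ b
              (Equiv.swap a ⟨b.val - 1, hc⟩ (Equiv.swap ⟨b.val - 1, hc⟩ b i))) := by
        funext i; rw [e1, Equiv.Perm.mul_apply, Equiv.Perm.mul_apply]
      rw [step]
      have s1 := swap_adj_of_jump ψ L hL hn hJ _ b hcb
        (fun j => x (Equiv.swap ⟨b.val - 1, hc⟩ b (Equiv.swap a ⟨b.val - 1, hc⟩ j)))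
      have s2 := ih a _ hca (fun k => x (Equiv.swap ⟨b.val - 1, hc⟩ b k))
      have s3 := swap_adj_of_jump ψ L hL hn hJ _ b hcb x
      exact s1.trans (s2.trans s3)
  rcases Nat.lt_trichotomy a.val b.val with h | h | h
  · exact key (b.val - a.val - 1) a b (by omega) x
  · have hab : a = b := Fin.ext h
    subst hab
    have : (fun i => x (Equiv.swap a a i)) = x := by funext i; simp [Equiv.swap_self]
    rw [this]
  · have := key (a.val - b.val - 1) b a (by omega) x
    simpa [Equiv.swap_comm] using this

/-! ## Axiom guards -/

/--
info: 'Summit.QuantumAdvantage.QuantumAdvantage.Theorems.TransferDial.JumpSym.swap_adj_of_jump' depends on axioms: [propext,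
 Classical.choice,
 Quot.sound]
-/
#guard_msgs in #print axioms swap_adj_of_jump

/--
info: 'Summit.QuantumAdvantage.QuantumAdvantage.Theorems.TransferDial.JumpSym.swap_of_jump' depends on axioms: [propext,
 Classical.choice,
 Quot.sound]
-/
#guard_msgs in #print axioms swap_of_jump

end Summit.QuantumAdvantage.QuantumAdvantage.Theorems.TransferDial.JumpSym
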